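import Mathlib
import HarnessLib
import Summits.AtomisticToContinuum.Crystallization.Theorems.ChessboardParticlePlanesLjLaminarWindowsVirial

/-!
# Crux `GroundStateVarianceCertificate` (stmt-AtomisticToContinuum-11859), line `registered`:
# stub `stub_virialSite` — the virial identity in site form

Helper file of route `PRVarianceCertificate`, crux `GroundStateVarianceCertificate`. For a finite
configuration `x : Fin N → ℝ³` and a radial weight `V` the site energies are
`siteEnergy V x i = ∑_{k ≠ i} V(|xᵢ - x_k|)`; the crux compares `s_i = ∑_{k ≠ i} r_{ik}⁻⁶` with
`t_i = ∑_{k ≠ i} r_{ik}⁻¹²`. In every Lennard-Jones ground state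
(`V_LJ(r) = r⁻¹²/12 - r⁻⁶/6`) the two totals agree,

  `∑_i t_i = ∑_i s_i`            (`stub_virialSite`),

because dilations `x ↦ c x` are competitors, so `c ↦ 𝓔(c x)` is stationary at `c = 1`
(zero pressure). The pair form `∑_{i<j} r_{ij}⁻¹² = ∑_{i<j} r_{ij}⁻⁶` (any dimension) is the
tree's `LjLaminarWindowsSketch.virial_sum_inv_pow_eq`; the site form follows by double counting,
`2 𝓔_V(x) = ∑_i siteEnergy V x i` (`two_mul_interactionEnergy`). All statements `[folklore]`
(Blanc–Lewin 2015, §1.2). Nothing else is here: the small-cluster bound, the periodic minimiser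
and the core domination are other stubs of the line.

Appended: the A-PRIORI WEAK CERTIFICATE `exists_weak_certificate` — the crux inequality
`∑_i s_i² ≤ C ∑_i t_i` for every Lennard-Jones ground state with SOME constant `C = 250·δ⁻⁶`
(uniform minimal distance `δ`, `LennardJonesMinimalDistance_holds`, and the shell sum
`sum_inv_pow_six_le`); the crux asks for the sharp constant `-24·e⋆`.
-/

noncomputable section

open scoped BigOperators
open Literature.MathematicalPhysics.StatisticalMechanics

namespace Summit.AtomisticToContinuum.Crystallization.Theorems.GroundStateVarianceCertificateLine

/-- The interaction energy of the pure power weight `r ↦ r⁻ⁿ` is the pair sum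
`∑_{i<j} r_{ij}⁻ⁿ` (definitional unfolding, recorded for rewriting). [folklore] -/
theorem interactionEnergy_inv_pow {d N : ℕ} (n : ℕ) (x : Fin N → EuclideanSpace ℝ (Fin d)) :
    interactionEnergy (fun r => (r⁻¹) ^ n) x =
      ∑ i, ∑ j ∈ Finset.Ioi i, (dist (x i) (x j))⁻¹ ^ n :=
  rfl

/-- **Stub `stub_virialSite` (virial identity, site form).** In every finite Lennard-Jones ground
state `x : Fin N → ℝ³` the total `r⁻¹²`-site energy equals the total `r⁻⁶`-site energy,
`∑_i ∑_{k ≠ i} r_{ik}⁻¹² = ∑_i ∑_{k ≠ i} r_{ik}⁻⁶` (zero pressure: dilations are competitors, so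
`c ↦ 𝓔(c x)` is stationary at `c = 1`; pair form `virial_sum_inv_pow_eq` plus double counting
`two_mul_interactionEnergy`). [folklore] -/
theorem stub_virialSite :
    ∀ (N : ℕ) (x : Fin N → EuclideanSpace ℝ (Fin 3)), IsGroundState lennardJones x →
      ∑ i, siteEnergy (fun r => (r⁻¹) ^ 12) x i = ∑ i, siteEnergy (fun r => (r⁻¹) ^ 6) x i := by
  intro N x hx
  rw [← two_mul_interactionEnergy (fun r => (r⁻¹) ^ 12) x,
    ← two_mul_interactionEnergy (fun r => (r⁻¹) ^ 6) x, interactionEnergy_inv_pow 12 x,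
    interactionEnergy_inv_pow 6 x,
    Summit.AtomisticToContinuum.Crystallization.Theorems.LjLaminarWindowsSketch.virial_sum_inv_pow_eq
      hx]

/-- **A-priori weak certificate.** The certificate inequality of the crux holds for every
Lennard-Jones ground state with SOME constant (here `250·δ⁻⁶` from the uniform minimal distance
`δ`: each site sum `s_i = ∑_{k ≠ i} r_{ik}⁻⁶` is at most `250·δ⁻⁶` by the shell sum, so
`∑ s_i² ≤ 250·δ⁻⁶ · ∑ s_i = 250·δ⁻⁶ · ∑ t_i` by the virial identity `stub_virialSite`); the crux
is the same inequality with the SHARP constant `-24·e⋆` tied to a periodic configuration.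
[folklore] -/
theorem exists_weak_certificate :
    ∃ C : ℝ, 0 < C ∧ ∀ (N : ℕ) (x : Fin N → EuclideanSpace ℝ (Fin 3)),
      IsGroundState lennardJones x →
        ∑ i, (siteEnergy (fun r => (r⁻¹) ^ 6) x i) ^ 2 ≤
          C * ∑ i, siteEnergy (fun r => (r⁻¹) ^ 12) x i := by
  obtain ⟨δ, hδ, hsep⟩ := LennardJonesMinimalDistance_holds
  refine ⟨250 * δ⁻¹ ^ 6, by positivity, fun N x hx => ?_⟩
  -- every `r⁻⁶`-site sum is bounded by the shell sum at the uniform minimal distance `δ`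
  have hsi : ∀ i, siteEnergy (fun r => (r⁻¹) ^ 6) x i ≤ 250 * δ⁻¹ ^ 6 := fun i => by
    unfold siteEnergy
    exact sum_inv_pow_six_le x hδ (fun k l hkl => hsep N x hx k l hkl) i
  have hs0 : ∀ i, 0 ≤ siteEnergy (fun r => (r⁻¹) ^ 6) x i := fun i => by
    unfold siteEnergy
    exact Finset.sum_nonneg fun k _ => pow_nonneg (inv_nonneg.2 dist_nonneg) _
  rw [stub_virialSite N x hx, Finset.mul_sum]
  refine Finset.sum_le_sum fun i _ => ?_
  rw [sq]
  exact mul_le_mul_of_nonneg_right (hsi i) (hs0 i)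

end Summit.AtomisticToContinuum.Crystallization.Theorems.GroundStateVarianceCertificateLine

end
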